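import Summits.MatrixMultiplication.MatrixMultiplication.Theorems.SaturationLadderTwinMember
import HarnessLib

/-!
# SaturationLadder — the twin-class ceiling for CONVEX COMBINATIONS of members (hull form)

Route `SaturationLadder` (sub-problem `MatrixMultiplication`), crux `SubexpSaturation`
(stmt-MatrixMultiplication-25909).  `SaturationLadderTwinClassNoBase.no_subcritical_base_class` showed that
no PADDED family of STAGE-2 twin-class certificates (`SaturationLadderTwinExact.omegaRect_one_tw_exact` +
`base_mono`) yields `Base(θ)` for `θ < θ_c = (3125/128)^{1/3}`.  Saturating pairs `(t, r)` (those with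
`ω(1,t,r) ≤ 1 + r`) are moreover a CONVEX set, by the Lotti–Romani joint convexity of `ω(x,y,z)`
(`Literature…RectangularExponentSubadditivity.LottiRomani1983_convexComb_le`), so the honest statement of
«the twin method cannot go below `θ_c`» quantifies over finite convex combinations
`(Σ wᵢ tᵢ, Σ wᵢ rᵢ)` of members.  This file proves that statement:

* `no_subcritical_base_hull`: for `1 < θ`, `θ³ < 3125/128` there is no constant `C` such that for every
  `s < 1` some finite convex combination of class members (each member's data and hypotheses VERBATIM those
  of `omegaRect_one_tw_exact`) has `s ≤ Σ wᵢ tᵢ` and `Σ wᵢ rᵢ ≤ C θ^{1/(1−s)}`.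

Proof (Markov + the per-member facts of `SaturationLadderTwinMember`, no Jensen needed): with `δ = 1 − s`
and `η = (c₂ − log θ)/(4 c₂)`, the members with `1 − tᵢ ≤ (1+η)δ` carry weight `≥ η/(1+η)` (every member has
`tᵢ ≤ 1`); each such member has `tᵢ ≥ 1/2`, `j+1 ≥ 1/(16(1+η)δ)` by `(C1)`, hence `(1−tᵢ) log rᵢ ≥ c₂ −
320/(jᵢ+1) ≥ c₂ − (c₂ − log θ)/4` by `(C2)` and so `rᵢ ≥ exp((c₂ − (c₂−log θ)/4)/((1+η)δ))`; all `rᵢ ≥ 0`,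
so `log Σ wᵢ rᵢ ≥ log(η/(1+η)) + (c₂ − (c₂ − log θ)/2)/δ`, contradicting `Σ wᵢ rᵢ ≤ C θ^{1/δ}` for small `δ`.
Together with `SaturationLadderTwinEndpoint.base_of_cube_ge`: the convex hull of the twin class certifies
`Base(θ)` iff `θ ≥ θ_c` — the method ceiling is exact and two-sided also for the hull.  No definitions, no
named facts, no sorry. [cite: CoppersmithWinograd1990, §8] [cite: AlmanDuanVassilevskaWilliamsXuXuZhou2025, §3.4]
[cite: LottiRomani1983, §1 (p. 173)]
-/

set_option linter.dupNamespace false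
-- (single-conjunct summit: the namespace repeats `MatrixMultiplication`)

noncomputable section

namespace Summit.MatrixMultiplication.MatrixMultiplication.Theorems.SaturationLadderTwinHullNoBase

open Literature.Computability.AlgebraicComplexity
open Summit.MatrixMultiplication.MatrixMultiplication.Theorems.SaturationLadderTwinClassNoBase
  (three_log_lt_of_cube_lt)
open Summit.MatrixMultiplication.MatrixMultiplication.Theorems.SaturationLadderTwinMember
  (member_t_le_one member_mass member_ceiling member_r_pos)

/-- **The twin-class ceiling, hull form.**  See the module docstring.
[cite: CoppersmithWinograd1990, §8] [cite: AlmanDuanVassilevskaWilliamsXuXuZhou2025, §3.4]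
[cite: LottiRomani1983, §1 (p. 173)] -/
theorem no_subcritical_base_hull {θ C : ℝ} (hθ : 1 < θ) (hθc : θ ^ 3 < (3125 : ℝ) / 128)
    (H : ∀ s : ℝ, 0 ≤ s → s < 1 → ∃ (m : ℕ) (w : Fin m → ℝ) (j n₁ n₂ n₃ n₄ n₅ n₆ : Fin m → ℕ),
      (∀ i, 0 ≤ w i) ∧ ∑ i, w i = 1 ∧ (∀ i, 0 < n₆ i) ∧ (∀ i, n₁ i + n₄ i + n₅ i = 2 * n₆ i) ∧
      (∀ i, n₂ i + n₃ i = 2 ^ (j i + 1) * n₆ i) ∧ (∀ i, 0 < (j i + 1) * n₃ i + n₅ i) ∧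
      (∀ i, shannonEntropy
          ![((n₁ i : ℝ) + n₄ i + n₅ i) / (n₁ i + n₂ i + n₃ i + n₄ i + n₅ i + n₆ i : ℕ),
            ((n₂ i : ℝ) + n₃ i) / (n₁ i + n₂ i + n₃ i + n₄ i + n₅ i + n₆ i : ℕ),
            (n₆ i : ℝ) / (n₁ i + n₂ i + n₃ i + n₄ i + n₅ i + n₆ i : ℕ)] ≤
        shannonEntropy
          ![((n₂ i : ℝ) + n₄ i + n₆ i) / (n₁ i + n₂ i + n₃ i + n₄ i + n₅ i + n₆ i : ℕ),
            ((n₁ i : ℝ) + n₃ i) / (n₁ i + n₂ i + n₃ i + n₄ i + n₅ i + n₆ i : ℕ),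
            (n₅ i : ℝ) / (n₁ i + n₂ i + n₃ i + n₄ i + n₅ i + n₆ i : ℕ)]) ∧
      (∀ i, shannonEntropy
          ![((n₁ i : ℝ) + n₄ i + n₅ i) / (n₁ i + n₂ i + n₃ i + n₄ i + n₅ i + n₆ i : ℕ),
            ((n₂ i : ℝ) + n₃ i) / (n₁ i + n₂ i + n₃ i + n₄ i + n₅ i + n₆ i : ℕ),
            (n₆ i : ℝ) / (n₁ i + n₂ i + n₃ i + n₄ i + n₅ i + n₆ i : ℕ)] ≤
        shannonEntropy
          ![((n₃ i : ℝ) + n₅ i + n₆ i) / (n₁ i + n₂ i + n₃ i + n₄ i + n₅ i + n₆ i : ℕ),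
            ((n₁ i : ℝ) + n₂ i) / (n₁ i + n₂ i + n₃ i + n₄ i + n₅ i + n₆ i : ℕ),
            (n₄ i : ℝ) / (n₁ i + n₂ i + n₃ i + n₄ i + n₅ i + n₆ i : ℕ)]) ∧
      s ≤ ∑ i, w i * ((j i : ℝ) * n₁ i / (((j i : ℝ) + 1) * n₃ i + n₅ i)) ∧
      ∑ i, w i * ((((j i : ℝ) + 1) * n₂ i + n₁ i + n₄ i) / (((j i : ℝ) + 1) * n₃ i + n₅ i)) ≤
        C * θ ^ (1 / (1 - s))) : False := by
  classical
  have hθ0 : 0 < θ := by linarith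
  have hlogθ : 0 < Real.log θ := Real.log_pos hθ
  set c₂ : ℝ := (5 * Real.log (5 / 4) + 3 * Real.log 2) / 3 with hc₂def
  have hθc' : Real.log θ < c₂ := by
    have := three_log_lt_of_cube_lt hθ0 hθc; rw [hc₂def]; linarith
  set g : ℝ := c₂ - Real.log θ with hgdef
  have hg : 0 < g := by rw [hgdef]; linarith
  have hgc : g ≤ c₂ := by rw [hgdef]; linarith
  have hc₂0 : 0 < c₂ := by linarith
  -- constants
  set η : ℝ := g / (4 * c₂) with hηdef
  have hη0 : 0 < η := by positivity
  have hηc : η * c₂ = g / 4 := by rw [hηdef]; field_simp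
  have hη1 : η ≤ 1 / 4 := by
    rw [hηdef, div_le_iff₀ (by positivity)]; linarith
  set c' : ℝ := c₂ - g / 4 with hc'def
  have hc'0 : 0 < c' := by rw [hc'def]; linarith
  set lam : ℝ := η / (1 + η) with hlamdef
  have hlam0 : 0 < lam := by positivity
  have hlam1 : lam ≤ 1 := by
    rw [hlamdef, div_le_one (by positivity)]; linarith
  set C' : ℝ := max C 1 with hC'def
  have hC'1 : 1 ≤ C' := le_max_right _ _
  have hC'0 : 0 < C' := by linarith
  have hlogC' : 0 ≤ Real.log C' := Real.log_nonneg hC'1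
  have hloglam : Real.log lam ≤ 0 := Real.log_nonpos hlam0.le hlam1
  set K : ℝ := Real.log C' - Real.log lam with hKdef
  have hK0 : 0 ≤ K := by rw [hKdef]; linarith
  set δ : ℝ := min (min (1 / 80) (g / 25600)) (g / (4 * (K + 1))) with hδdef
  have hδ0 : 0 < δ := lt_min (lt_min (by norm_num) (by positivity)) (by positivity)
  have hδa : δ ≤ 1 / 80 := (min_le_left _ _).trans (min_le_left _ _)
  have hδb : δ ≤ g / 25600 := (min_le_left _ _).trans (min_le_right _ _)
  have hδc : δ ≤ g / (4 * (K + 1)) := min_le_right _ _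
  have hηδ : (1 + η) * δ ≤ 1 / 64 := by
    have := mul_le_mul (show 1 + η ≤ 5 / 4 by linarith) hδa hδ0.le (by norm_num)
    linarith
  -- the hull point at `s = 1 - δ`
  obtain ⟨m, w, j, n₁, n₂, n₃, n₄, n₅, n₆, hw, hsum, hn₆, hz₁, hz₂, -, hX, hY, hst, hr⟩ :=
    H (1 - δ) (by linarith) (by linarith)
  rw [sub_sub_cancel] at hr
  obtain ⟨T, hT⟩ : ∃ T : Fin m → ℝ, ∀ i,
      T i = (j i : ℝ) * n₁ i / (((j i : ℝ) + 1) * n₃ i + n₅ i) := ⟨_, fun i => rfl⟩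
  obtain ⟨R, hR⟩ : ∃ R : Fin m → ℝ, ∀ i,
      R i = (((j i : ℝ) + 1) * n₂ i + n₁ i + n₄ i) / (((j i : ℝ) + 1) * n₃ i + n₅ i) :=
    ⟨_, fun i => rfl⟩
  have hst' : 1 - δ ≤ ∑ i, w i * T i := by simp only [hT]; exact hst
  have hr' : ∑ i, w i * R i ≤ C' * θ ^ (1 / δ) := by
    simp only [hR]
    exact hr.trans (mul_le_mul_of_nonneg_right (le_max_left _ _) (Real.rpow_nonneg hθ0.le _))
  -- per-member facts
  have hT1 : ∀ i, T i ≤ 1 := fun i => by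
    rw [hT]
    exact member_t_le_one (j i) (n₁ i) (n₂ i) (n₃ i) (n₄ i) (n₅ i) (n₆ i) (hn₆ i) (hz₁ i) (hz₂ i)
      (hX i) (hY i)
  have hR0 : ∀ i, 0 ≤ R i := fun i => by rw [hR]; positivity
  have hgoodfact : ∀ i, 1 - T i ≤ (1 + η) * δ → Real.exp (c' / ((1 + η) * δ)) ≤ R i := by
    intro i hi
    have hJ0 : (0 : ℝ) < (j i : ℝ) + 1 := by positivity
    have ht : 1 / 2 ≤ T i := by linarith
    have htx := ht
    rw [hT] at htx
    have hTm := member_mass (j i) (n₁ i) (n₂ i) (n₃ i) (n₄ i) (n₅ i) (n₆ i) (hn₆ i) (hz₁ i)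
      (hz₂ i) (hX i) (hY i) htx
    rw [← hT] at hTm
    -- `1 ≤ 20 δ (j+1)`, hence `j ≥ 3` and `320/(j+1) ≤ g/4`
    have h20 : 1 ≤ 20 * δ * ((j i : ℝ) + 1) := by
      have a1 := mul_le_mul_of_nonneg_right hi hJ0.le
      have a2 := mul_le_mul_of_nonneg_right
        (mul_le_mul_of_nonneg_right (show 1 + η ≤ 5 / 4 by linarith) hδ0.le) hJ0.le
      linarith only [hTm, a1, a2]
    have hJ4 : (4 : ℝ) ≤ (j i : ℝ) + 1 := by
      rcases le_or_gt 4 ((j i : ℝ) + 1) with h | h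
      · exact h
      · have := mul_lt_mul_of_pos_left h (show 0 < 20 * δ by positivity)
        linarith only [h20, this, hδa]
    have hj3 : 3 ≤ j i := by
      have : (3 : ℝ) ≤ (j i : ℝ) := by linarith only [hJ4]
      exact_mod_cast this
    have h320 : 320 / ((j i : ℝ) + 1) ≤ g / 4 := by
      rw [div_le_iff₀ hJ0]
      have := mul_le_mul_of_nonneg_right (show 6400 * δ ≤ g / 4 by linarith only [hδb]) hJ0.le
      linarith only [h20, this]
    have hC2 := member_ceiling (j i) (n₁ i) (n₂ i) (n₃ i) (n₄ i) (n₅ i) (n₆ i) hj3 (hn₆ i) (hz₁ i)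
      (hz₂ i) (hX i) (hY i) htx
    rw [← hT, ← hR, ← hc₂def] at hC2
    have hc'le : c' ≤ (1 - T i) * Real.log (R i) := by rw [hc'def]; linarith only [hC2, h320]
    have h1T0 : 0 < 1 - T i := by
      rcases le_or_gt (1 - T i) 0 with h | h
      · have := mul_le_mul_of_nonneg_right h hJ0.le
        linarith only [hTm, this]
      · exact h
    have hlogR : c' / (1 - T i) ≤ Real.log (R i) := by
      rw [div_le_iff₀ h1T0]; linarith only [hc'le]
    have hlogR' : c' / ((1 + η) * δ) ≤ Real.log (R i) :=
      (div_le_div_of_nonneg_left hc'0.le h1T0 hi).trans hlogR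
    have hRpos : 0 < R i := by
      rw [hR]; exact member_r_pos (j i) (n₁ i) (n₂ i) (n₃ i) (n₄ i) (n₅ i) htx
    calc Real.exp (c' / ((1 + η) * δ)) ≤ Real.exp (Real.log (R i)) := Real.exp_le_exp.mpr hlogR'
      _ = R i := Real.exp_log hRpos
  -- Markov: the members with `1 - T i ≤ (1+η) δ` carry weight at least `η/(1+η)`
  set good := Finset.univ.filter (fun i => 1 - T i ≤ (1 + η) * δ) with hgood_def
  set bad := Finset.univ.filter (fun i => ¬ (1 - T i ≤ (1 + η) * δ)) with hbad_def
  have hsplit : ∑ i ∈ good, w i + ∑ i ∈ bad, w i = 1 := by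
    rw [hgood_def, hbad_def, Finset.sum_filter_add_sum_filter_not]; exact hsum
  have h1T : ∑ i, w i * (1 - T i) ≤ δ := by
    have e : ∑ i, w i * (1 - T i) = ∑ i, w i - ∑ i, w i * T i := by
      rw [← Finset.sum_sub_distrib]
      exact Finset.sum_congr rfl (fun i _ => by ring)
    rw [e, hsum]; linarith only [hst']
  have hbad1 : (∑ i ∈ bad, w i) * ((1 + η) * δ) ≤ δ := by
    rw [Finset.sum_mul]
    calc ∑ i ∈ bad, w i * ((1 + η) * δ) ≤ ∑ i ∈ bad, w i * (1 - T i) :=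
          Finset.sum_le_sum (fun i hi =>
            mul_le_mul_of_nonneg_left (le_of_lt (not_le.mp (Finset.mem_filter.mp hi).2)) (hw i))
      _ ≤ ∑ i, w i * (1 - T i) :=
          Finset.sum_le_sum_of_subset_of_nonneg (Finset.filter_subset _ _)
            (fun i _ _ => mul_nonneg (hw i) (by linarith only [hT1 i]))
      _ ≤ δ := h1T
  have hbad2 : (∑ i ∈ bad, w i) * (1 + η) ≤ 1 := by
    have h' : (∑ i ∈ bad, w i) * (1 + η) * δ ≤ 1 * δ := by rw [one_mul, mul_assoc]; exact hbad1
    exact le_of_mul_le_mul_right h' hδ0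
  have hgoodw : lam ≤ ∑ i ∈ good, w i := by
    have e : ∑ i ∈ good, w i = 1 - ∑ i ∈ bad, w i := by linarith only [hsplit]
    rw [e, hlamdef, div_le_iff₀ (by positivity)]
    nlinarith only [hbad2, hη0]
  -- lower bound on the hull ordinate
  have hE0 : 0 < Real.exp (c' / ((1 + η) * δ)) := Real.exp_pos _
  have hsum_good : (∑ i ∈ good, w i) * Real.exp (c' / ((1 + η) * δ)) ≤ ∑ i, w i * R i := by
    rw [Finset.sum_mul]
    calc ∑ i ∈ good, w i * Real.exp (c' / ((1 + η) * δ)) ≤ ∑ i ∈ good, w i * R i :=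
          Finset.sum_le_sum (fun i hi =>
            mul_le_mul_of_nonneg_left (hgoodfact i (Finset.mem_filter.mp hi).2) (hw i))
      _ ≤ ∑ i, w i * R i :=
          Finset.sum_le_sum_of_subset_of_nonneg (Finset.filter_subset _ _)
            (fun i _ _ => mul_nonneg (hw i) (hR0 i))
  have hlow : lam * Real.exp (c' / ((1 + η) * δ)) ≤ ∑ i, w i * R i :=
    (mul_le_mul_of_nonneg_right hgoodw hE0.le).trans hsum_good
  have hpos : 0 < ∑ i, w i * R i := lt_of_lt_of_le (mul_pos hlam0 hE0) hlow
  have hlog_low : Real.log lam + c' / ((1 + η) * δ) ≤ Real.log (∑ i, w i * R i) := by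
    have := Real.log_le_log (mul_pos hlam0 hE0) hlow
    rwa [Real.log_mul hlam0.ne' hE0.ne', Real.log_exp] at this
  have hlog_up : Real.log (∑ i, w i * R i) ≤ Real.log C' + 1 / δ * Real.log θ := by
    have := Real.log_le_log hpos hr'
    rwa [Real.log_mul hC'0.ne' (Real.rpow_pos_of_pos hθ0 _).ne', Real.log_rpow hθ0] at this
  -- multiply the chain by `δ` and conclude
  have hmul := mul_le_mul_of_nonneg_left (hlog_low.trans hlog_up) hδ0.le
  have e1 : δ * (Real.log lam + c' / ((1 + η) * δ)) = δ * Real.log lam + c' / (1 + η) := by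
    rw [mul_add, mul_div_assoc', mul_comm (1 + η) δ, mul_div_mul_left _ _ hδ0.ne']
  have e2 : δ * (Real.log C' + 1 / δ * Real.log θ) = δ * Real.log C' + Real.log θ := by
    rw [mul_add, ← mul_assoc, mul_one_div_cancel hδ0.ne', one_mul]
  rw [e1, e2] at hmul
  have hcη : c₂ - g / 2 ≤ c' / (1 + η) := by
    rw [le_div_iff₀ (by positivity), hc'def]
    have := mul_nonneg hg.le hη0.le
    linarith only [hηc, this]
  have hfin : g / 2 ≤ δ * K := by
    rw [hKdef]; linarith only [hmul, hcη, hgdef]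
  have hδK : δ * K ≤ g / 4 := by
    calc δ * K ≤ g / (4 * (K + 1)) * K := mul_le_mul_of_nonneg_right hδc hK0
      _ ≤ g / 4 := by
          rw [div_mul_eq_mul_div, div_le_div_iff₀ (by positivity) (by positivity)]
          have := mul_nonneg hg.le hK0
          linarith only [this, hg]
  linarith only [hfin, hδK, hg]

end Summit.MatrixMultiplication.MatrixMultiplication.Theorems.SaturationLadderTwinHullNoBase
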